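import Summits.KontsevichZagierPeriods.KontsevichZagierPeriods.Theorems.UnfoldedStokesStokesGenerationLineReduction
import Summits.KontsevichZagierPeriods.KontsevichZagierPeriods.Theorems.TypeAGenerationConjecture
import Literature.NumberTheory.Transcendental.AyoubPeriodSeriesDescentNumberField

/-!
# `StokesGeneration` (stmt-KontsevichZagierPeriods-3586), line `Sketch`: the line reduction against the
# NAMED conjecture `TypeAGenerationConjecture`

Thin restatement of `Theorems/UnfoldedStokesStokesGenerationLineReduction.lean` with the open stub (T)
taken as the registered summit-side conjecture `TypeAGenerationConjecture`
(`Theorems/TypeAGenerationConjecture.lean`; = `stub_typeAGeneration` verbatim), so that the results are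
recorded as conditional on a NAMED obligation:

* `typeAGenerationConjecture_iff_fresan`, `typeAGenerationConjecture_iff_numberField`,
  `typeAGenerationConjecture_iff_algebraicClosure` — the conjecture is, respectively, Fresán's printed
  Conjecture 3.5 (`k = ℚ`), Ayoub's printed Conjecture 1.1 over all number fields, and its `ℚ̄`-instance
  (Literature `AyoubPeriodSeriesDescent{,NumberField}.lean`: `𝒪_{ℚ-alg} = 𝒪_{ℚ̄-alg} = 𝒪_{k-alg}`).
* `kzKernelConjecture_of_typeAGenerationConjecture`, `stokesGeneration_of_typeAGenerationConjecture`,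
  `kontsevichZagierPeriods_of_typeAGenerationConjecture` — **`TypeAGenerationConjecture ∧ CubeNashNormalForm
  ⇒` kernel conjecture, crux, summit** (`CubeNashNormalForm` = item stmt-3574 of route LiftingCriteria).
* `sum_cubeNash_mem_relations_of_typeAGenerationConjecture`,
  `equivalent_of_value_eq_of_dimLEOne_of_typeAGenerationConjecture` — **`TypeAGenerationConjecture` alone ⇒**
  the Kontsevich–Zagier conjecture for cube–Nash combinations and for representations of dimension `≤ 1`.
* `stub_lineReductionNamed` — the registered form `TypeAGenerationConjecture → CubeNashNormalForm →
  StokesGeneration`.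

References: Ayoub 2015 Conj. 1.1; Fresán 2024 Conj. 3.5; Kontsevich–Zagier 2001 §1.2 Conjecture 1.
-/

noncomputable section

-- `Summit.KontsevichZagierPeriods.KontsevichZagierPeriods.…` is the tree's mandated layout (single-conjunct summit).
set_option linter.dupNamespace false

namespace Summit.KontsevichZagierPeriods.KontsevichZagierPeriods.StokesGenerationLine

open MeasureTheory Set
open Literature.NumberTheory.Transcendental
open Literature.NumberTheory.Transcendental.KZ
open Literature.NumberTheory.Transcendental.AyoubRel
open Summit.KontsevichZagierPeriods.KontsevichZagierPeriods (TypeAGenerationConjecture)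
open Summit.KontsevichZagierPeriods.KontsevichZagierPeriods.Theses.UnfoldedStokes (StokesGeneration)
open Summit.KontsevichZagierPeriods.KontsevichZagierPeriods.Theses.LiftingCriteria (CubeNashNormalForm)

/-! ## The named conjecture is the printed conjecture -/

/-- **`TypeAGenerationConjecture` ⇔ Fresán's Conjecture 3.5 as printed** (`k = ℚ`: the kernel of
`∫_{[0,1]^∞}` on `𝒪_{ℚ-alg}(𝔻̄^∞)` is the `ℚ`-span of the elements `∂g/∂zᵢ − g|_{zᵢ=1} + g|_{zᵢ=0}`).
[cite: Fresan2024, Conj. 3.5] -/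
theorem typeAGenerationConjecture_iff_fresan :
    TypeAGenerationConjecture ↔
      ∀ F ∈ Oan (algebraMap ℚ ℂ), intC F = 0 →
        F ∈ kSpan (algebraMap ℚ ℂ)
          {x : CSeries | ∃ G ∈ Oan (algebraMap ℚ ℂ), ∃ i : ℕ, x = relAC i G} :=
  typeAGeneration_forall_iff_rat

/-- **`TypeAGenerationConjecture` ⇔ Ayoub's Conjecture 1.1 over all number fields** (its printed
generality). [cite: Ayoub2015, Conj. 1.1] -/
theorem typeAGenerationConjecture_iff_numberField :
    TypeAGenerationConjecture ↔
      ∀ (K : Type) [Field K] [NumberField K] (σ : K →+* ℂ),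
        ∀ F ∈ Oan σ, intC F = 0 →
          F ∈ kSpan σ {x : CSeries | ∃ G ∈ Oan σ, ∃ i : ℕ, x = relAC i G} :=
  typeAGeneration_forall_iff_numberField

/-- **`TypeAGenerationConjecture` ⇔ its instance `k = ℚ̄`** (the only instance the line uses).
[cite: Ayoub2015, Conj. 1.1] -/
theorem typeAGenerationConjecture_iff_algebraicClosure :
    TypeAGenerationConjecture ↔
      ∀ F ∈ Oan (algebraMap (algebraicClosure ℚ ℂ) ℂ), intC F = 0 →
        F ∈ kSpan (algebraMap (algebraicClosure ℚ ℂ) ℂ)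
          {x : CSeries | ∃ G ∈ Oan (algebraMap (algebraicClosure ℚ ℂ) ℂ), ∃ i : ℕ, x = relAC i G} :=
  typeAGeneration_forall_iff_algebraicClosure

/-! ## Conditional results against the named conjecture -/

/-- **`TypeAGenerationConjecture` ⇒ the Kontsevich–Zagier conjecture for cube–Nash combinations**: a
`ℤ`-combination of closed-cube representations with `ℚ`-semialgebraic integrands real-analytic near the
closed cube and of value `0` is a relation of the four-move calculus. [cite: Ayoub2015, Conj. 1.1] -/
theorem sum_cubeNash_mem_relations_of_typeAGenerationConjecture (hT : TypeAGenerationConjecture)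
    (S : ℕ) (nS : Fin S → ℕ) (g : (i : Fin S) → (Fin (nS i) → ℝ) → ℝ)
    (U : (i : Fin S) → Set (Fin (nS i) → ℝ)) (ε : Fin S → ℤ) (s : (i : Fin S) → IntegralRep (nS i))
    (hNash : ∀ i, IsOpen (U i) ∧ Set.pi Set.univ (fun _ : Fin (nS i) => Set.Icc (0:ℝ) 1) ⊆ (U i) ∧
      IsSemialgebraicFunOn ℚ (U i) (g i) ∧ AnalyticOnNhd ℝ (g i) (U i))
    (hs : ∀ i, (s i).domain = Set.pi Set.univ (fun _ : Fin (nS i) => Set.Icc (0:ℝ) 1) ∧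
      ∀ z ∈ Set.pi Set.univ (fun _ : Fin (nS i) => Set.Icc (0:ℝ) 1), (s i).integrand z = g i z)
    (h0 : eval (∑ i, ε i • of (s i)) = 0) :
    ∑ i, ε i • of (s i) ∈ relations :=
  sum_cubeNash_mem_relations_of_typeA (typeAGenerationConjecture_iff_algebraicClosure.mp hT)
    S nS g U ε s hNash hs h0

/-- **`TypeAGenerationConjecture ∧ CubeNashNormalForm ⇒ KZKernelConjecture`.**
[cite: KontsevichZagier2001, §1.2 Conjecture 1] -/
theorem kzKernelConjecture_of_typeAGenerationConjecture (hT : TypeAGenerationConjecture)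
    (hN : CubeNashNormalForm) : KZKernelConjecture :=
  kzKernelConjecture_of_typeA_of_cubeNashNormalForm (typeAGenerationConjecture_iff_algebraicClosure.mp hT) hN

/-- **`TypeAGenerationConjecture ∧ CubeNashNormalForm ⇒` the crux `StokesGeneration`.**
[cite: KontsevichZagier2001, §1.2 Conjecture 1] -/
theorem stokesGeneration_of_typeAGenerationConjecture (hT : TypeAGenerationConjecture)
    (hN : CubeNashNormalForm) : StokesGeneration :=
  stokesGeneration_of_typeA_of_cubeNashNormalForm (typeAGenerationConjecture_iff_algebraicClosure.mp hT) hN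

/-- **`TypeAGenerationConjecture ∧ CubeNashNormalForm ⇒` the summit `KontsevichZagierPeriods`.**
[cite: KontsevichZagier2001, §1.2 Conjecture 1] -/
theorem kontsevichZagierPeriods_of_typeAGenerationConjecture (hT : TypeAGenerationConjecture)
    (hN : CubeNashNormalForm) : _root_.KontsevichZagierPeriods :=
  kontsevichZagierPeriods_of_typeA_of_cubeNashNormalForm
    (typeAGenerationConjecture_iff_algebraicClosure.mp hT) hN

/-- **`TypeAGenerationConjecture` ⇒ the Kontsevich–Zagier conjecture in dimension `≤ 1`**: any two
integral representations of dimensions `≤ 1` with the same value are KZ-equivalent (no normal-form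
hypothesis). [cite: Ayoub2015, Conj. 1.1] -/
theorem equivalent_of_value_eq_of_dimLEOne_of_typeAGenerationConjecture (hT : TypeAGenerationConjecture)
    {n m : ℕ} (hn : n ≤ 1) (hm : m ≤ 1) (r : IntegralRep n) (r' : IntegralRep m)
    (hv : r.value = r'.value) : Equivalent r r' :=
  equivalent_of_value_eq_of_dimLEOne_of_typeA (typeAGenerationConjecture_iff_algebraicClosure.mp hT)
    hn hm r r' hv

/-- The registered form: `TypeAGenerationConjecture → CubeNashNormalForm → StokesGeneration`.
[cite: Ayoub2015, Conj. 1.1] -/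
theorem stub_lineReductionNamed : TypeAGenerationConjecture → CubeNashNormalForm → StokesGeneration :=
  stokesGeneration_of_typeAGenerationConjecture

end Summit.KontsevichZagierPeriods.KontsevichZagierPeriods.StokesGenerationLine
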